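import Mathlib.Analysis.SpecialFunctions.Exp
import Mathlib.Algebra.Order.BigOperators.Ring.Finset
import Mathlib.Analysis.SpecialFunctions.Pow.Real
import HarnessLib

/-!
# Window recursion of the one-level step: decay-relative per-window tracking sums to a decay-relative energy comparison (K1L_D helper)

Helper file of route `SolenoidalFractalHomogenisation`, crux K1L_D `LagrangianRenormalisationStepDesign` (stmt-AnomalousDissipation-27980), for the
planned stub `stub_windowBookkeepingL` (S3 of the tenure's split D24-6 of `stub_oneLevelL_IW`; lead memo
`Cruxes/LagrangianRenormalisationStep/Lines/onelevel-L2-conjugation.md`, consumer memo `B-lead-1.md` §1–§5).  This is the REAL-VARIABLE CORE of that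
bookkeeping, with no PDE objects:

* § 1 ONE MODE ACROSS WINDOWS.  Let `b₀ ≥ 0` be the initial amplitude of an active mode, `q j ∈ [0,1]` the exact decay factor of the EFFECTIVE
  (renormalised, level-`m`) dynamics across refresh window `j`, so that the effective amplitude after `J` windows is `Q_J b₀`, `Q_J = ∏_{j<J} q j`, and
  let the true (level-`m+1`, Lagrangian-frame) slow amplitudes `a j ≥ 0` obey the DECAY-RELATIVE window law
  `a (j+1) ≤ (q j + ε (1 − q j)) · a j` (all four per-window error sources of B-lead-1 — (V)'s rate error `e·min(1, r̄t)`, the burst `r̄P`, the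
  distortion `δ ≤ θ₀ρ^{1/16}` of (S2), the leak (F_T)·(C) — are of this form, see § 3).  Then (`amp_le_of_window_recursion`)
  `a J ≤ (Q_J + ε (1 − Q_J)) · b₀`: the errors do NOT accumulate with the number of windows but only with the total decay `1 − Q_J`
  (`prod_decayRel_le`: `∏ (q j + ε(1 − q j)) ≤ Q_J + ε(1 − Q_J)`), and in energy (`sq_sub_sq_le_of_window_recursion`)
  `a J ² − (Q_J b₀)² ≤ 2ε · (b₀² − (Q_J b₀)²)` — decay-relative with constant `2ε`.
* § 2 ASSEMBLY OVER MODES.  If every active mode's energy of `u` is within `ε ×` (that mode's effective drop) of the effective one, the inactive part of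
  `u` does not grow, and the inactive initial energy (the class-`R` tail, `…LagrangianStepDatumTail`) is `≤ ε' ×` the effective drop, then
  `(1 − ε − ε') · drop v ≤ drop u` (`drop_ge_of_modewise`) — the shape of the conclusion of `stub_oneLevelL_IW`.
* § 3 CONVERSIONS showing the per-window sources are decay-relative: `1 − e^{−x} ≥ min(1,x)/2`, `min(1, r̄T) ≤ (r̄/r) min(1, rT)`, hence
  `e·min(1, r̄T) ≤ 2e(r̄/r)(1 − q)` and `r̄P ≤ 2·max((r̄/r)(P/T), r̄P)·(1 − q)` whenever `q ≤ e^{−rT}`, `0 < r ≤ r̄`.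

Pure real algebra; no definitions, no named facts, no sorry.  NOT a proof of the one-level comparison, of the crux, of Onsager's conjecture or of
anomalous dissipation — rung-leaf F-D1.A0 bookkeeping only.  Prover seat `ad-k3l-bookkeeping-p1` g4, 2026-08-28.
-/

set_option linter.dupNamespace false

noncomputable section

namespace Summit.AnomalousDissipation.AnomalousDissipation.Theorems.SolenoidalFractalHomogenisation.LagrangianStep

open Finset Real

/-! ## § 1. One mode across the refresh windows -/

/-- Two decay-relative factors compose to a decay-relative factor: for `Q, q ∈ [0,1]` and `ε ∈ [0,1]`,
`(Q + ε(1−Q))·(q + ε(1−q)) ≤ Qq + ε(1 − Qq)` (the difference is `ε(1−ε)(1−Q)(1−q) ≥ 0`). [folklore] -/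
theorem decayRel_factor_mul_le {Q q ε : ℝ} (hQ1 : Q ≤ 1) (hq1 : q ≤ 1) (hε0 : 0 ≤ ε) (hε1 : ε ≤ 1) :
    (Q + ε * (1 - Q)) * (q + ε * (1 - q)) ≤ Q * q + ε * (1 - Q * q) := by
  have h1 : 0 ≤ 1 - Q := by linarith
  have h2 : 0 ≤ 1 - q := by linarith
  have h3 : 0 ≤ 1 - ε := by linarith
  have key : Q * q + ε * (1 - Q * q) - (Q + ε * (1 - Q)) * (q + ε * (1 - q)) = ε * (1 - ε) * ((1 - Q) * (1 - q)) := by ring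
  have : 0 ≤ ε * (1 - ε) * ((1 - Q) * (1 - q)) := by positivity
  linarith

/-- A decay factor in `[0,1]` perturbed decay-relatively stays in `[0,1]`. [folklore] -/
theorem decayRel_factor_mem {q ε : ℝ} (hq0 : 0 ≤ q) (hq1 : q ≤ 1) (hε0 : 0 ≤ ε) (hε1 : ε ≤ 1) :
    0 ≤ q + ε * (1 - q) ∧ q + ε * (1 - q) ≤ 1 := by
  constructor
  · have : 0 ≤ ε * (1 - q) := mul_nonneg hε0 (by linarith)
    linarith
  · nlinarith

/-- Products of factors in `[0,1]` lie in `[0,1]`. [folklore] -/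
theorem prod_mem_unit_interval (q : ℕ → ℝ) (hq : ∀ j, 0 ≤ q j ∧ q j ≤ 1) (J : ℕ) :
    0 ≤ ∏ j ∈ range J, q j ∧ ∏ j ∈ range J, q j ≤ 1 :=
  ⟨prod_nonneg fun j _ => (hq j).1, prod_le_one (fun j _ => (hq j).1) fun j _ => (hq j).2⟩

/-- **Errors accumulate with the total decay, not with the number of windows**:
`∏_{j<J} (q j + ε(1 − q j)) ≤ (∏_{j<J} q j) + ε(1 − ∏_{j<J} q j)`. [folklore] -/
theorem prod_decayRel_le (q : ℕ → ℝ) (hq : ∀ j, 0 ≤ q j ∧ q j ≤ 1) {ε : ℝ} (hε0 : 0 ≤ ε) (hε1 : ε ≤ 1) (J : ℕ) :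
    ∏ j ∈ range J, (q j + ε * (1 - q j)) ≤ (∏ j ∈ range J, q j) + ε * (1 - ∏ j ∈ range J, q j) := by
  induction J with
  | zero => simp
  | succ J ih =>
    rw [prod_range_succ, prod_range_succ]
    obtain ⟨_, hP1⟩ := prod_mem_unit_interval q hq J
    have hf0 : 0 ≤ q J + ε * (1 - q J) := (decayRel_factor_mem (hq J).1 (hq J).2 hε0 hε1).1
    calc (∏ j ∈ range J, (q j + ε * (1 - q j))) * (q J + ε * (1 - q J))
        ≤ ((∏ j ∈ range J, q j) + ε * (1 - ∏ j ∈ range J, q j)) * (q J + ε * (1 - q J)) :=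
          mul_le_mul_of_nonneg_right ih hf0
      _ ≤ (∏ j ∈ range J, q j) * q J + ε * (1 - (∏ j ∈ range J, q j) * q J) :=
          decayRel_factor_mul_le hP1 (hq J).2 hε0 hε1

/-- **Window recursion ⇒ cumulative amplitude tracking.**  If `0 ≤ a 0 ≤ b₀` and `a (j+1) ≤ (q j + ε(1 − q j))·a j` for all `j` (`q j ∈ [0,1]`,
`ε ∈ [0,1]`), then `a J ≤ (Q_J + ε(1 − Q_J))·b₀`, `Q_J = ∏_{j<J} q j`. [folklore] -/
theorem amp_le_of_window_recursion (a q : ℕ → ℝ) {b₀ ε : ℝ} (hb₀ : 0 ≤ b₀) (ha0 : a 0 ≤ b₀)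
    (hq : ∀ j, 0 ≤ q j ∧ q j ≤ 1) (hε0 : 0 ≤ ε) (hε1 : ε ≤ 1)
    (hrec : ∀ j, a (j + 1) ≤ (q j + ε * (1 - q j)) * a j) (J : ℕ) :
    a J ≤ ((∏ j ∈ range J, q j) + ε * (1 - ∏ j ∈ range J, q j)) * b₀ := by
  have hstep : ∀ J, a J ≤ (∏ j ∈ range J, (q j + ε * (1 - q j))) * b₀ := by
    intro J
    induction J with
    | zero => simpa using ha0
    | succ J ih =>
      have hf0 : 0 ≤ q J + ε * (1 - q J) := (decayRel_factor_mem (hq J).1 (hq J).2 hε0 hε1).1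
      calc a (J + 1) ≤ (q J + ε * (1 - q J)) * a J := hrec J
        _ ≤ (q J + ε * (1 - q J)) * ((∏ j ∈ range J, (q j + ε * (1 - q j))) * b₀) := mul_le_mul_of_nonneg_left ih hf0
        _ = (∏ j ∈ range (J + 1), (q j + ε * (1 - q j))) * b₀ := by rw [prod_range_succ]; ring
  exact (hstep J).trans (mul_le_mul_of_nonneg_right (prod_decayRel_le q hq hε0 hε1 J) hb₀)

/-- **Energy form**: under the same window law and `0 ≤ a J`, the mode energy of `u` exceeds the effective one by at most `2ε ×` the effective
drop: `a J ² − (Q_J b₀)² ≤ 2ε·(b₀² − (Q_J b₀)²)`. [folklore] -/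
theorem sq_sub_sq_le_of_window_recursion (a q : ℕ → ℝ) {b₀ ε : ℝ} (hb₀ : 0 ≤ b₀) (ha0 : a 0 ≤ b₀) (ha : ∀ j, 0 ≤ a j)
    (hq : ∀ j, 0 ≤ q j ∧ q j ≤ 1) (hε0 : 0 ≤ ε) (hε1 : ε ≤ 1)
    (hrec : ∀ j, a (j + 1) ≤ (q j + ε * (1 - q j)) * a j) (J : ℕ) :
    a J ^ 2 - ((∏ j ∈ range J, q j) * b₀) ^ 2 ≤ 2 * ε * (b₀ ^ 2 - ((∏ j ∈ range J, q j) * b₀) ^ 2) := by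
  set Q : ℝ := ∏ j ∈ range J, q j with hQ_def
  obtain ⟨hQ0, hQ1⟩ := prod_mem_unit_interval q hq J
  rw [← hQ_def] at hQ0 hQ1
  have hX := amp_le_of_window_recursion a q hb₀ ha0 hq hε0 hε1 hrec J
  rw [← hQ_def] at hX
  have hX0 : 0 ≤ (Q + ε * (1 - Q)) * b₀ := mul_nonneg (decayRel_factor_mem hQ0 hQ1 hε0 hε1).1 hb₀
  have h1 : a J ^ 2 ≤ ((Q + ε * (1 - Q)) * b₀) ^ 2 := pow_le_pow_left₀ (ha J) hX 2
  -- `((Q + ε(1−Q)) b₀)² − (Q b₀)² = ε(1−Q)(2Q + ε(1−Q)) b₀² ≤ 2ε(1−Q)(1+Q) b₀²`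
  have h2 : ((Q + ε * (1 - Q)) * b₀) ^ 2 - (Q * b₀) ^ 2 ≤ 2 * ε * (b₀ ^ 2 - (Q * b₀) ^ 2) := by
    have e : 2 * ε * (b₀ ^ 2 - (Q * b₀) ^ 2) - (((Q + ε * (1 - Q)) * b₀) ^ 2 - (Q * b₀) ^ 2) =
        ε * (1 - Q) * b₀ ^ 2 * (2 - ε * (1 - Q)) := by ring
    have h1Q : 0 ≤ 1 - Q := by linarith
    have h3 : 0 ≤ 2 - ε * (1 - Q) := by nlinarith
    have : 0 ≤ ε * (1 - Q) * b₀ ^ 2 * (2 - ε * (1 - Q)) := by positivity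
    linarith
  linarith

/-- Lower companion (two-sided tracking, for completeness): if also `(q j − ε(1 − q j))·a j ≤ a (j+1)` and `b₀ ≤ a 0`... only the one-sided
form above is consumed by `stub_oneLevelL_IW`; we record the elementary lower PRODUCT bound `Q_J − ε(1 − Q_J) ≤ ∏ (q j − ε(1−q j))` when every
factor is nonnegative. [folklore] -/
theorem prod_decayRel_ge (q : ℕ → ℝ) (hq : ∀ j, 0 ≤ q j ∧ q j ≤ 1) {ε : ℝ} (hε0 : 0 ≤ ε)
    (hpos : ∀ j, 0 ≤ q j - ε * (1 - q j)) (J : ℕ) :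
    (∏ j ∈ range J, q j) - ε * (1 - ∏ j ∈ range J, q j) ≤ ∏ j ∈ range J, (q j - ε * (1 - q j)) := by
  induction J with
  | zero => simp
  | succ J ih =>
    rw [prod_range_succ, prod_range_succ]
    obtain ⟨hP0, hP1⟩ := prod_mem_unit_interval q hq J
    set P := ∏ j ∈ range J, q j
    set P' := ∏ j ∈ range J, (q j - ε * (1 - q j))
    have hqJ := hq J
    have h1 : (P - ε * (1 - P)) * (q J - ε * (1 - q J)) ≤ P' * (q J - ε * (1 - q J)) :=
      mul_le_mul_of_nonneg_right ih (hpos J)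
    -- `P q − ε(1 − P q) ≤ (P − ε(1−P))(q − ε(1−q))`: difference `ε(1−P)(1−q)(1+ε) ≥ 0`... sign check below
    have h2 : P * q J - ε * (1 - P * q J) ≤ (P - ε * (1 - P)) * (q J - ε * (1 - q J)) := by
      have e : (P - ε * (1 - P)) * (q J - ε * (1 - q J)) - (P * q J - ε * (1 - P * q J)) =
          ε * ((1 - P) * (1 - q J)) * (1 + ε) := by ring
      have : 0 ≤ ε * ((1 - P) * (1 - q J)) * (1 + ε) := by
        have : 0 ≤ (1 - P) * (1 - q J) := mul_nonneg (by linarith) (by linarith [hqJ.2])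
        positivity
      linarith
    exact h2.trans h1

/-! ## § 2. Assembly over the active modes and the inactive tail -/

/-- **Mode-wise decay-relative comparison ⇒ drop comparison.**  Finite set `s` of active modes with initial energies `E0`, energies `V` (effective)
and `U` (true) at the observation time, inactive energies `tail0 ≥ 0` (initial), `Vt ≥ 0` (effective), `Ut` (true); if
`U ℓ ≤ V ℓ + ε (E0 ℓ − V ℓ)` and `V ℓ ≤ E0 ℓ` on `s` (`ε ∈ [0,1]`) and the inactive part of `u` does not grow (`Ut ≤ tail0`), then
`(1 − ε)·drop_v − tail0 ≤ drop_u` for `drop_v = E − (Σ V + Vt)`, `drop_u = E − (Σ U + Ut)`, `E = Σ E0 + tail0`. [folklore] -/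
theorem drop_ge_of_modewise_sub_tail {ι : Type*} (s : Finset ι) (E0 V U : ι → ℝ) {tail0 Vt Ut ε : ℝ}
    (hε0 : 0 ≤ ε) (hε1 : ε ≤ 1) (hUV : ∀ ℓ ∈ s, U ℓ ≤ V ℓ + ε * (E0 ℓ - V ℓ))
    (htail0 : 0 ≤ tail0) (hUt : Ut ≤ tail0) (hVt : 0 ≤ Vt) :
    (1 - ε) * ((∑ ℓ ∈ s, E0 ℓ + tail0) - (∑ ℓ ∈ s, V ℓ + Vt)) - tail0 ≤
      (∑ ℓ ∈ s, E0 ℓ + tail0) - (∑ ℓ ∈ s, U ℓ + Ut) := by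
  have hsumU : ∑ ℓ ∈ s, U ℓ ≤ ∑ ℓ ∈ s, V ℓ + ε * (∑ ℓ ∈ s, E0 ℓ - ∑ ℓ ∈ s, V ℓ) := by
    rw [← sum_sub_distrib, mul_sum, ← sum_add_distrib]
    exact sum_le_sum hUV
  set SE := ∑ ℓ ∈ s, E0 ℓ
  set SV := ∑ ℓ ∈ s, V ℓ
  set SU := ∑ ℓ ∈ s, U ℓ
  -- `Σ(E0 − V) = drop_v − tail0 + Vt`
  have e1 : ε * (SE - SV) = ε * ((SE + tail0) - (SV + Vt)) - ε * tail0 + ε * Vt := by ring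
  have h1 : 0 ≤ ε * tail0 := mul_nonneg hε0 htail0
  have h2 : 0 ≤ ε * Vt := mul_nonneg hε0 hVt
  have h3 : ε * Vt ≤ Vt := by nlinarith
  nlinarith

/-- … hence, when the inactive initial energy (the class-`R` tail, `…LagrangianStepDatumTail`) is decay-relative small, `tail0 ≤ ε'·drop_v`:
`(1 − ε − ε')·drop_v ≤ drop_u` — the shape of the conclusion of `stub_oneLevelL_IW`. [folklore] -/
theorem drop_ge_of_modewise {ι : Type*} (s : Finset ι) (E0 V U : ι → ℝ) {tail0 Vt Ut ε ε' : ℝ}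
    (hε0 : 0 ≤ ε) (hε1 : ε ≤ 1) (hUV : ∀ ℓ ∈ s, U ℓ ≤ V ℓ + ε * (E0 ℓ - V ℓ))
    (htail0 : 0 ≤ tail0) (hUt : Ut ≤ tail0) (hVt : 0 ≤ Vt)
    (htail : tail0 ≤ ε' * ((∑ ℓ ∈ s, E0 ℓ + tail0) - (∑ ℓ ∈ s, V ℓ + Vt))) :
    (1 - ε - ε') * ((∑ ℓ ∈ s, E0 ℓ + tail0) - (∑ ℓ ∈ s, V ℓ + Vt)) ≤
      (∑ ℓ ∈ s, E0 ℓ + tail0) - (∑ ℓ ∈ s, U ℓ + Ut) := by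
  have h := drop_ge_of_modewise_sub_tail s E0 V U hε0 hε1 hUV htail0 hUt hVt
  have e : (1 - ε - ε') * ((∑ ℓ ∈ s, E0 ℓ + tail0) - (∑ ℓ ∈ s, V ℓ + Vt)) =
      (1 - ε) * ((∑ ℓ ∈ s, E0 ℓ + tail0) - (∑ ℓ ∈ s, V ℓ + Vt)) - ε' * ((∑ ℓ ∈ s, E0 ℓ + tail0) - (∑ ℓ ∈ s, V ℓ + Vt)) := by
    ring
  linarith

/-- The same with the mode energies of `u` split into slow and fast content, `U = Us + Uf`, each compared separately:
`Us ℓ ≤ V ℓ + ε₁ (E0 ℓ − V ℓ)` (window recursion, § 1) and `Uf ℓ ≤ ε₂ (E0 ℓ − V ℓ)` (decay-relative corrector + leak content, (C)/(F_T)). [folklore] -/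
theorem drop_ge_of_modewise_slow_fast {ι : Type*} (s : Finset ι) (E0 V Us Uf : ι → ℝ) {tail0 Vt Ut ε₁ ε₂ ε' : ℝ}
    (hε₁ : 0 ≤ ε₁) (hε₂ : 0 ≤ ε₂) (hε : ε₁ + ε₂ ≤ 1)
    (hUs : ∀ ℓ ∈ s, Us ℓ ≤ V ℓ + ε₁ * (E0 ℓ - V ℓ)) (hUf : ∀ ℓ ∈ s, Uf ℓ ≤ ε₂ * (E0 ℓ - V ℓ))
    (htail0 : 0 ≤ tail0) (hUt : Ut ≤ tail0) (hVt : 0 ≤ Vt)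
    (htail : tail0 ≤ ε' * ((∑ ℓ ∈ s, E0 ℓ + tail0) - (∑ ℓ ∈ s, V ℓ + Vt))) :
    (1 - (ε₁ + ε₂) - ε') * ((∑ ℓ ∈ s, E0 ℓ + tail0) - (∑ ℓ ∈ s, V ℓ + Vt)) ≤
      (∑ ℓ ∈ s, E0 ℓ + tail0) - (∑ ℓ ∈ s, (Us ℓ + Uf ℓ) + Ut) := by
  refine drop_ge_of_modewise s E0 V (fun ℓ => Us ℓ + Uf ℓ) (add_nonneg hε₁ hε₂) hε (fun ℓ hℓ => ?_) htail0 hUt hVt htail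
  have h1 := hUs ℓ hℓ
  have h2 := hUf ℓ hℓ
  have : (ε₁ + ε₂) * (E0 ℓ - V ℓ) = ε₁ * (E0 ℓ - V ℓ) + ε₂ * (E0 ℓ - V ℓ) := by ring
  show Us ℓ + Uf ℓ ≤ V ℓ + (ε₁ + ε₂) * (E0 ℓ - V ℓ)
  linarith

/-! ## § 3. The per-window error sources are decay-relative -/

/-- `min(1, x)/2 ≤ 1 − e^{−x}` for `x ≥ 0` (`e^{−x} ≤ 1/(1+x) ≤ 1 − x/2` on `[0,1]`, `e^{−x} ≤ e^{−1} ≤ 1/2` beyond). [folklore] -/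
theorem half_min_one_le_one_sub_exp_neg {x : ℝ} (hx : 0 ≤ x) : min 1 x / 2 ≤ 1 - Real.exp (-x) := by
  have hinv : ∀ y : ℝ, 0 ≤ y → Real.exp (-y) ≤ 1 / (y + 1) := by
    intro y hy
    have h1 : y + 1 ≤ Real.exp y := Real.add_one_le_exp y
    rw [Real.exp_neg, inv_eq_one_div]
    exact one_div_le_one_div_of_le (by linarith) h1
  rcases le_or_gt x 1 with h | h
  · rw [min_eq_right h]
    have h2 : 1 / (x + 1) ≤ 1 - x / 2 := by
      rw [div_le_iff₀ (by linarith)]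
      nlinarith
    linarith [hinv x hx]
  · rw [min_eq_left h.le]
    have h1 : Real.exp (-x) ≤ Real.exp (-1) := Real.exp_le_exp.2 (by linarith)
    have h2 : Real.exp (-1) ≤ 1 / ((1:ℝ) + 1) := hinv 1 zero_le_one
    norm_num at h2
    linarith

/-- `min(1, r̄T) ≤ (r̄/r)·min(1, rT)` for `0 < r ≤ r̄`, `0 ≤ T`. [folklore] -/
theorem min_one_mul_le_ratio_mul_min {r rbar T : ℝ} (hr : 0 < r) (hrr : r ≤ rbar) :
    min 1 (rbar * T) ≤ rbar / r * min 1 (r * T) := by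
  have hratio : 1 ≤ rbar / r := by rw [le_div_iff₀ hr]; linarith
  rcases le_or_gt (r * T) 1 with h | h
  · rw [min_eq_right h]
    calc min 1 (rbar * T) ≤ rbar * T := min_le_right _ _
      _ = rbar / r * (r * T) := by field_simp
  · rw [min_eq_left h.le, mul_one]
    exact (min_le_left _ _).trans hratio

/-- **(V)'s rate error is decay-relative**: if the effective decay factor of the window satisfies `q ≤ e^{−rT}` (`0 < r ≤ r̄`, `T ≥ 0`), then
`e·min(1, r̄T) ≤ (2e·r̄/r)·(1 − q)` for `e ≥ 0`. [folklore] -/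
theorem rateError_le_decayRel {e r rbar T q : ℝ} (he : 0 ≤ e) (hr : 0 < r) (hrr : r ≤ rbar) (hT : 0 ≤ T)
    (hq : q ≤ Real.exp (-(r * T))) :
    e * min 1 (rbar * T) ≤ 2 * e * (rbar / r) * (1 - q) := by
  have h1 := min_one_mul_le_ratio_mul_min (T := T) hr hrr
  have h2 := half_min_one_le_one_sub_exp_neg (mul_nonneg hr.le hT)
  have h3 : min 1 (r * T) ≤ 2 * (1 - q) := by linarith
  have hratio : 0 ≤ rbar / r := div_nonneg (hr.le.trans hrr) hr.le
  calc e * min 1 (rbar * T) ≤ e * (rbar / r * min 1 (r * T)) := mul_le_mul_of_nonneg_left h1 he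
    _ ≤ e * (rbar / r * (2 * (1 - q))) := mul_le_mul_of_nonneg_left (mul_le_mul_of_nonneg_left h3 hratio) he
    _ = 2 * e * (rbar / r) * (1 - q) := by ring

/-- **The burst term is decay-relative**: with `q ≤ e^{−rT}`, `0 < r ≤ r̄`, `0 < T`, `P ≥ 0`:
`r̄P ≤ 2·max((r̄/r)·(P/T), r̄P)·(1 − q)` — the first entry is the (T5) ratio `P/T = ρ^{1/16}` (short decay per window), the second the absolute
size `r̄P = O(ρ^{1/4})` on the active band (long decay per window). [folklore] -/
theorem burst_le_decayRel {r rbar T P q : ℝ} (hr : 0 < r) (hrr : r ≤ rbar) (hT : 0 < T) (hP : 0 ≤ P)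
    (hq : q ≤ Real.exp (-(r * T))) :
    rbar * P ≤ 2 * max (rbar / r * (P / T)) (rbar * P) * (1 - q) := by
  have hrbar : 0 ≤ rbar := hr.le.trans hrr
  have h2 := half_min_one_le_one_sub_exp_neg (mul_nonneg hr.le hT.le)
  have hq1 : q ≤ 1 := hq.trans (Real.exp_le_one_iff.2 (by nlinarith))
  have h1q : 0 ≤ 1 - q := by linarith
  rcases le_or_gt (r * T) 1 with h | h
  · rw [min_eq_right h] at h2
    -- `r̄P = (r̄/r)(P/T)·(rT) ≤ (r̄/r)(P/T)·2(1−q)`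
    have e1 : rbar * P = rbar / r * (P / T) * (r * T) := by field_simp
    have hA : 0 ≤ rbar / r * (P / T) := by positivity
    calc rbar * P = rbar / r * (P / T) * (r * T) := e1
      _ ≤ rbar / r * (P / T) * (2 * (1 - q)) := mul_le_mul_of_nonneg_left (by linarith) hA
      _ = 2 * (rbar / r * (P / T)) * (1 - q) := by ring
      _ ≤ 2 * max (rbar / r * (P / T)) (rbar * P) * (1 - q) :=
          mul_le_mul_of_nonneg_right (mul_le_mul_of_nonneg_left (le_max_left _ _) (by norm_num)) h1q
  · rw [min_eq_left h.le] at h2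
    have h1q' : 1 ≤ 2 * (1 - q) := by linarith
    have hB : 0 ≤ rbar * P := mul_nonneg hrbar hP
    calc rbar * P = rbar * P * 1 := (mul_one _).symm
      _ ≤ rbar * P * (2 * (1 - q)) := mul_le_mul_of_nonneg_left h1q' hB
      _ = 2 * (rbar * P) * (1 - q) := by ring
      _ ≤ 2 * max (rbar / r * (P / T)) (rbar * P) * (1 - q) :=
          mul_le_mul_of_nonneg_right (mul_le_mul_of_nonneg_left (le_max_right _ _) (by norm_num)) h1q

/-- **A relative (absolute-in-amplitude) per-window error `λ·a` is decay-relative when `λ ≤ κ·(1 − q)`** — the form in which the leak (F_T)·(C)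
and the distortion work of (S2) enter (`κ` from `…TemplateDissipationScale.exists_forall_le_kbar_mul_N_sq`, resp. `θ₀ρ^{1/16}`):
the window law `a' ≤ q·a + (η + λ)·a` with `η ≤ ε₁(1−q)`, `λ ≤ ε₂(1−q)` is `a' ≤ (q + (ε₁+ε₂)(1−q))·a`. [folklore] -/
theorem window_law_of_sources {a a' q η lam ε₁ ε₂ : ℝ} (ha : 0 ≤ a) (hstep : a' ≤ q * a + (η + lam) * a)
    (hη : η ≤ ε₁ * (1 - q)) (hlam : lam ≤ ε₂ * (1 - q)) :
    a' ≤ (q + (ε₁ + ε₂) * (1 - q)) * a := by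
  have : (η + lam) * a ≤ ((ε₁ + ε₂) * (1 - q)) * a := mul_le_mul_of_nonneg_right (by linarith) ha
  linarith

end Summit.AnomalousDissipation.AnomalousDissipation.Theorems.SolenoidalFractalHomogenisation.LagrangianStep

end
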